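/-
Copyright (c) 2026 the pub-hodgecm-mathlib formalisation cell (harness21).  Prover seat hodgecm-mathlib-K2E5-p04 (g0),
Track B «K2-LIT» ∕ h413, engine E5 «TamagawaUnitary», unit G, DEALS BATCH #9 (6): DEFS LEAF #3m, ED. 2 (arch × finite product decomposition).  2026-09-04.
-/
import Summits.HodgeConjecture.HodgeConjecture.Theorems.K2E5QuatAdelicRestrictedProductDefs   -- ★ #3m ED. 1 (p855852, this seat): `quatFinAdelicUnits`, `quatFinAdelicEquiv`, `quatEvalPlace`, `quatLocalPiEquiv`, `quatLocalPiInt`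
import Literature.NumberTheory.Automorphic.UnitaryGroupAdelicProduct                       -- ★ template `archPart`/`finPart`/`adelicProdEquiv`; brings ★ `arch`, `archFormOf`, `conjMixed`, `GLn.toMixed/ofInfinite/ofFinite`
import Literature.NumberTheory.Automorphic.AdelicUnitaryGroupDatum                         -- ★ `conjAdele_complexConj : conjAdele L⁺ L c = adeleConj L`
import HarnessLib

/-!
# K2 ∕ E5 — DEFS LEAF #3m, ED. 2: `(D_h ⊗ 𝔸)^× ≃ₜ* (D_h ⊗ ℝ)^× × (D_h ⊗ 𝔸_{L⁺,f})^×` and the compatibility with the local projections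

Second of the three files of DEFS LEAF #3m (DEALS BATCH #9 (6), K2E5-plan (g2)).  ★ #3d put the adelic unit group
`quatAdelicUnits L Ha ≤ GL₂(𝔸_L)` of the matrix model `D(c ⊗ 1, h ⊗ 1)` of the CM quaternion algebra `D_h`; ★ #3i its local projections
`quatAdelicUnitsToLocal v : ↥quatAdelicUnits →* ↥(quatLocalUnits v)` and its level `quatAdelicUnitsLevel = ∏_v Λ_v^×`; ★ #3m ED. 1 (this seat)
the finite-adelic unit group `quatFinAdelicUnits ≤ GL₂(𝔸_{L,f})` with `quatFinAdelicEquiv : ↥quatFinAdelicUnits ≃ₜ* Πʳ v, [quatLocalPi v, quatLocalPiInt v]`.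
This file splits off the archimedean factor and ties the three together:

* §1 `quatArchUnits L Ha ≤ GL₂(L ⊗_ℚ ℝ)` (`mixedSpace L`) — the archimedean unit group `(D_h ⊗ ℝ)^×` (★ #3d `quatModelUnits` with ★ `conjMixed`,
  ★ `archFormOf`), closed, locally compact, second countable (§6).
* §2 `mem_quatAdelicUnits_iff_toMixed_sndHom : G ∈ (D_h ⊗ 𝔸)^× ↔ G_∞ ∈ (D_h ⊗ ℝ)^× ∧ G_f ∈ (D_h ⊗ 𝔸_{L⁺,f})^×` — the defining relation
  `((c⊗1)G)ᵀ (h⊗1) = (h⊗1) adj G` over `𝔸_L = L_∞ × 𝔸_{L,f}` splits into its two parts (`map_adeleFst_rel_iff`, `map_adeleSnd_rel_iff`); hence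
  `ofInfinite_mem_quatAdelicUnits_iff` / `ofFinite_mem_quatAdelicUnits_iff`.
* §3 the component homs `quatArchPart`, `quatFinPart`, the sections `quatArchToAdelic`, `quatFinAdelicToAdelic`, and **`quatAdelicProdEquiv :
  ↥(quatAdelicUnits L Ha) ≃ₜ* ↥(quatArchUnits L Ha) × ↥(quatFinAdelicUnits L Ha)`**, `g ↦ (g_∞, g_f)` (twin of ★ `UnitaryGroup.adelicProdEquiv`); the level
  is arch-free: `mem_quatAdelicUnitsLevel_iff_quatFinPart_mem` (`rfl`).
* §4 **COMPATIBILITY** `quatAdelicUnitsToLocal_eq_quatLocalPiEquiv_quatEvalPlace : quatAdelicUnitsToLocal v x = quatLocalPiEquiv v (quatEvalPlace v (quatFinPart x))`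
  (entries `(i,j,w) ↦ ((x_{ij})_f)_w` on both sides) and `eventually_quatAdelicUnitsToLocal_mem_level`.
* §5 `mem_quatAdelicUnitsLevel_iff_forall_toLocal : x ∈ ∏_v Λ_v^× ↔ ∀ v, x_v ∈ Λ_v^×` — ★ #3i's level IS the product of ★ #3f's local levels.

Sibling ED. 3 `K2E5QuatUnitsProductHaar` transports `|ω_{D^×,trd}|_∞ ⊗ rpMeasure (λ_v • quatLocalMulHaar)` along `quatAdelicProdEquiv` and `quatFinAdelicEquiv`.

Mathematically this is Borel–Jacquet's `G(𝔸) = G_∞ × G(𝔸_f)` [cite: BorelJacquet1979, §4.1] for `G = D_h^×` [cite: VignerasLNM800, Ch. III §1], with the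
local components of Platonov–Rapinchuk [cite: PlatonovRapinchuk1994, §5.1]; the Lean road is the verbatim twin of ★ `UnitaryGroupAdelicProduct` with the unitary
relation replaced by the model's relation (the only new matrix algebra is §2: `adj` commutes with ring maps, Mathlib `RingHom.map_adjugate`).

HONEST LABEL: HC_CM is proved only modulo the 7 printed citations (2 remaining named inputs: hLiu418 = stmt-HodgeConjecture-24832,
h413 = stmt-HodgeConjecture-24833) until rung 0 closes.  Definitions + structural lemmas only (helper lane, `--supports stmt-HodgeConjecture-24833`);
closes no item.  RULES KEPT: no `instance`, no `notation`, no `sorry`, no `def … : Prop` hypothesis; docstring on every declaration; axioms TRIO.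
-/

set_option autoImplicit false
set_option linter.dupNamespace false

noncomputable section

namespace Summit.HodgeConjecture.HodgeConjecture.Cruxes.H413.K2E5QuatAdelicProdDecomposition

open NumberField NumberField.mixedEmbedding IsDedekindDomain Topology Filter
open Literature.NumberTheory.Automorphic Literature.NumberTheory.Automorphic.UnitaryGroup
open Literature.NumberTheory.Weil1982.UnitaryFinTopForm
open Summit.HodgeConjecture.HodgeConjecture.Cruxes.H413.K2E5QuatAdelicMatrixModel
open Summit.HodgeConjecture.HodgeConjecture.Cruxes.H413.K2E5QuatLocalMeasure
open Summit.HodgeConjecture.HodgeConjecture.Cruxes.H413.K2E5QuatAdelicNrd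
open Summit.HodgeConjecture.HodgeConjecture.Cruxes.H413.K2E5QuatAdelicRestrictedProduct
open scoped Matrix MatrixGroups RestrictedProduct

variable (L : Type) [Field L] [NumberField L] [IsCMField L] (Ha : Matrix (Fin 2) (Fin 2) L)

/-! ## §1 The archimedean unit group `(D_h ⊗_ℚ ℝ)^× ≤ GL₂(L ⊗_ℚ ℝ)` -/

/-- **`(D_h ⊗_ℚ ℝ)^× ≤ GL₂(L ⊗_ℚ ℝ)`** (`mixedSpace L = ∏_{w ∣ ∞} ℂ` for CM `L`): the unit group of the archimedean matrix model
`{x ∈ M₂(L ⊗ ℝ) : ((c ⊗ 1)x)ᵀ (h ⊗ 1) = (h ⊗ 1) adj x}` (★ #3d `quatModelUnits` with ★ `conjMixed` and ★ `archFormOf L 2 h = h ⊗ 1`; the twin of ★ `UnitaryGroup.arch`).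
[cite: VignerasLNM800, Ch. III §1 (X_A^×, archimedean components)] [cite: BorelJacquet1979, §4.1] -/
def quatArchUnits : Subgroup (GL (Fin 2) (mixedSpace L)) :=
  quatModelUnits (conjMixed (↥(maximalRealSubfield L)) L (IsCMField.complexConj L)) (archFormOf L 2 Ha)

/-- Membership: `((c ⊗ 1)g)ᵀ (h ⊗ 1) = (h ⊗ 1) adj g` in `M₂(L ⊗ ℝ)`. [cite: VignerasLNM800, Ch. III §1] -/
theorem mem_quatArchUnits_iff (g : GL (Fin 2) (mixedSpace L)) :
    g ∈ quatArchUnits L Ha ↔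
      (((g : GL (Fin 2) (mixedSpace L)) : Matrix (Fin 2) (Fin 2) (mixedSpace L)).map (conjMixed (↥(maximalRealSubfield L)) L (IsCMField.complexConj L)))ᵀ *
          archFormOf L 2 Ha =
        archFormOf L 2 Ha * Matrix.adjugate ((g : GL (Fin 2) (mixedSpace L)) : Matrix (Fin 2) (Fin 2) (mixedSpace L)) :=
  mem_quatModelUnits_iff _ _ g

/-- `(D_h ⊗ ℝ)^×` is closed in `GL₂(L ⊗ ℝ)` (★ `continuous_conjMixed`). [cite: PlatonovRapinchuk1994, §5.1] -/
theorem isClosed_quatArchUnits : IsClosed (quatArchUnits L Ha : Set (GL (Fin 2) (mixedSpace L))) := by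
  have h : (quatArchUnits L Ha : Set (GL (Fin 2) (mixedSpace L))) =
      {g | (((g : GL (Fin 2) (mixedSpace L)) : Matrix (Fin 2) (Fin 2) (mixedSpace L)).map (conjMixed (↥(maximalRealSubfield L)) L (IsCMField.complexConj L)))ᵀ *
          archFormOf L 2 Ha = archFormOf L 2 Ha * Matrix.adjugate ((g : GL (Fin 2) (mixedSpace L)) : Matrix (Fin 2) (Fin 2) (mixedSpace L))} :=
    Set.ext fun g => mem_quatArchUnits_iff L Ha g
  have h1 : Continuous fun g : GL (Fin 2) (mixedSpace L) => (g : Matrix (Fin 2) (Fin 2) (mixedSpace L)) := Units.continuous_val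
  rw [h]
  exact isClosed_eq (((h1.matrix_map (continuous_conjMixed _ L _)).matrix_transpose).mul continuous_const) (continuous_const.mul h1.matrix_adjugate)

/-! ## §2 Components of adelic points: `g ∈ (D_h ⊗ 𝔸)^× ↔ g_∞ ∈ (D_h ⊗ ℝ)^× ∧ g_f ∈ (D_h ⊗ 𝔸_{L⁺,f})^×` -/

omit [IsCMField L] in
/-- Two matrices over `𝔸_L = L_∞ × 𝔸_{L,f}` agree iff their archimedean and finite parts agree (iff form of ★ `matrix_adele_ext`). [folklore] -/
theorem matrix_adele_eq_iff (M M' : Matrix (Fin 2) (Fin 2) (AdeleRing (𝓞 L) L)) :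
    M = M' ↔ M.map (adeleFst L) = M'.map (adeleFst L) ∧ M.map (adeleSnd L) = M'.map (adeleSnd L) :=
  ⟨fun h => ⟨congrArg (fun A : Matrix (Fin 2) (Fin 2) (AdeleRing (𝓞 L) L) => A.map (adeleFst L)) h,
    congrArg (fun A : Matrix (Fin 2) (Fin 2) (AdeleRing (𝓞 L) L) => A.map (adeleSnd L)) h⟩, fun h => matrix_adele_ext L 2 h.1 h.2⟩

/-- **Finite part of the defining relation.** The image under `M ↦ M_f` of `((c⊗1)G)ᵀ (h⊗1) = (h⊗1) adj G` is the defining relation of `G_f = GLn.sndHom G` in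
`(D_h ⊗ 𝔸_{L⁺,f})^×` (`(c ⊗ 1)_f = conjFiniteAdele`, `(h ⊗ 1)_f = finiteAdelicForm`, `adj` commutes with ring maps). [cite: BorelJacquet1979, §4.1] -/
theorem map_adeleSnd_rel_iff (G : GL (Fin 2) (AdeleRing (𝓞 L) L)) :
    ((((G : Matrix (Fin 2) (Fin 2) (AdeleRing (𝓞 L) L)).map (adeleConj L))ᵀ * Ha.map (algebraMap L (AdeleRing (𝓞 L) L))).map (adeleSnd L) =
        (Ha.map (algebraMap L (AdeleRing (𝓞 L) L)) * Matrix.adjugate (G : Matrix (Fin 2) (Fin 2) (AdeleRing (𝓞 L) L))).map (adeleSnd L)) ↔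
      GLn.sndHom 2 L G ∈ quatFinAdelicUnits L Ha := by
  rw [mem_quatFinAdelicUnits_iff]
  have hsnd : (G : Matrix (Fin 2) (Fin 2) (AdeleRing (𝓞 L) L)).map (adeleSnd L) =
      ((GLn.sndHom 2 L G : GL (Fin 2) (FiniteAdeleRing (𝓞 L) L)) : Matrix (Fin 2) (Fin 2) (FiniteAdeleRing (𝓞 L) L)) := rfl
  have hσ : ((G : Matrix (Fin 2) (Fin 2) (AdeleRing (𝓞 L) L)).map (adeleConj L)).map (adeleSnd L) =
      (((GLn.sndHom 2 L G : GL (Fin 2) (FiniteAdeleRing (𝓞 L) L)) : Matrix (Fin 2) (Fin 2) (FiniteAdeleRing (𝓞 L) L))).map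
        (conjFiniteAdele (↥(maximalRealSubfield L)) L (IsCMField.complexConj L)) := by
    rw [Matrix.map_map,
      show (adeleSnd L ∘ adeleConj L : AdeleRing (𝓞 L) L → FiniteAdeleRing (𝓞 L) L) =
        conjFiniteAdele (↥(maximalRealSubfield L)) L (IsCMField.complexConj L) ∘ adeleSnd L from rfl,
      ← Matrix.map_map, hsnd]
  have hH : (Ha.map (algebraMap L (AdeleRing (𝓞 L) L))).map (adeleSnd L) = finiteAdelicForm L 2 Ha := by
    rw [Matrix.map_map]; rfl
  have hadj : (Matrix.adjugate (G : Matrix (Fin 2) (Fin 2) (AdeleRing (𝓞 L) L))).map (adeleSnd L) =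
      Matrix.adjugate ((GLn.sndHom 2 L G : GL (Fin 2) (FiniteAdeleRing (𝓞 L) L)) : Matrix (Fin 2) (Fin 2) (FiniteAdeleRing (𝓞 L) L)) := by
    rw [← RingHom.mapMatrix_apply, RingHom.map_adjugate, RingHom.mapMatrix_apply, hsnd]
  rw [Matrix.map_mul, Matrix.map_mul, Matrix.transpose_map, hσ, hH, hadj]

omit [IsCMField L] in
/-- Entries of `g_∞ = GLn.toMixed G` transported back to `L_∞`: the archimedean parts of the entries of `G`. [folklore] -/
theorem map_toMixed_ringEquiv_symm (G : GL (Fin 2) (AdeleRing (𝓞 L) L)) :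
    ((GLn.toMixed 2 L G : GL (Fin 2) (mixedSpace L)) : Matrix (Fin 2) (Fin 2) (mixedSpace L)).map (InfiniteAdeleRing.ringEquiv_mixedSpace L).symm.toRingHom =
      (G : Matrix (Fin 2) (Fin 2) (AdeleRing (𝓞 L) L)).map (adeleFst L) := by
  ext i j
  simp only [Matrix.map_apply]
  change (InfiniteAdeleRing.ringEquiv_mixedSpace L).symm
      (InfiniteAdeleRing.ringEquiv_mixedSpace L (((G : Matrix (Fin 2) (Fin 2) (AdeleRing (𝓞 L) L)) i j).1)) = _
  rw [RingEquiv.symm_apply_apply]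
  rfl

/-- **Archimedean part of the defining relation.** The image under `M ↦ M_∞` of `((c⊗1)G)ᵀ (h⊗1) = (h⊗1) adj G` is (the transport along ★
`InfiniteAdeleRing.ringEquiv_mixedSpace` of) the defining relation of `G_∞ = GLn.toMixed G` in `(D_h ⊗ ℝ)^×` (★ `ringEquiv_symm_conjMixed`, ★ `adelicForm_map_fst`).
[cite: BorelJacquet1979, §4.1] -/
theorem map_adeleFst_rel_iff (G : GL (Fin 2) (AdeleRing (𝓞 L) L)) :
    ((((G : Matrix (Fin 2) (Fin 2) (AdeleRing (𝓞 L) L)).map (adeleConj L))ᵀ * Ha.map (algebraMap L (AdeleRing (𝓞 L) L))).map (adeleFst L) =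
        (Ha.map (algebraMap L (AdeleRing (𝓞 L) L)) * Matrix.adjugate (G : Matrix (Fin 2) (Fin 2) (AdeleRing (𝓞 L) L))).map (adeleFst L)) ↔
      GLn.toMixed 2 L G ∈ quatArchUnits L Ha := by
  rw [mem_quatArchUnits_iff]
  set e' : mixedSpace L →+* InfiniteAdeleRing L := (InfiniteAdeleRing.ringEquiv_mixedSpace L).symm.toRingHom with he'
  set g : Matrix (Fin 2) (Fin 2) (mixedSpace L) := ((GLn.toMixed 2 L G : GL (Fin 2) (mixedSpace L)) : Matrix (Fin 2) (Fin 2) (mixedSpace L)) with hg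
  have hinj : Function.Injective fun M : Matrix (Fin 2) (Fin 2) (mixedSpace L) => M.map e' :=
    fun A B h => (InfiniteAdeleRing.ringEquiv_mixedSpace L).symm.mapMatrix.injective h
  have hfst : g.map e' = (G : Matrix (Fin 2) (Fin 2) (AdeleRing (𝓞 L) L)).map (adeleFst L) := map_toMixed_ringEquiv_symm L G
  have hσ : (g.map (conjMixed (↥(maximalRealSubfield L)) L (IsCMField.complexConj L))).map e' =
      ((G : Matrix (Fin 2) (Fin 2) (AdeleRing (𝓞 L) L)).map (adeleConj L)).map (adeleFst L) := by
    rw [Matrix.map_map,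
      show (e' ∘ conjMixed (↥(maximalRealSubfield L)) L (IsCMField.complexConj L) : mixedSpace L → InfiniteAdeleRing L) =
        (MulSemiringAction.toRingHom (L ≃ₐ[↥(maximalRealSubfield L)] L) (InfiniteAdeleRing L) (IsCMField.complexConj L)) ∘ e' from
        funext fun x => ringEquiv_symm_conjMixed (↥(maximalRealSubfield L)) L (IsCMField.complexConj L) x,
      ← Matrix.map_map, hfst, Matrix.map_map, Matrix.map_map]
    rfl
  have hH : (archFormOf L 2 Ha).map e' = (Ha.map (algebraMap L (AdeleRing (𝓞 L) L))).map (adeleFst L) :=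
    (adelicForm_map_fst L 2 Ha).symm
  have hadj : (Matrix.adjugate g).map e' = (Matrix.adjugate (G : Matrix (Fin 2) (Fin 2) (AdeleRing (𝓞 L) L))).map (adeleFst L) := by
    rw [← RingHom.mapMatrix_apply, RingHom.map_adjugate, RingHom.mapMatrix_apply, hfst, ← RingHom.mapMatrix_apply (adeleFst L),
      ← RingHom.mapMatrix_apply (adeleFst L), RingHom.map_adjugate]
  rw [Matrix.map_mul, Matrix.map_mul, Matrix.transpose_map, ← hσ, ← hH, ← hadj, ← Matrix.transpose_map, ← Matrix.map_mul, ← Matrix.map_mul]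
  exact ⟨fun h => hinj h, fun h => congrArg (fun M : Matrix (Fin 2) (Fin 2) (mixedSpace L) => M.map e') h⟩

/-- **`G ∈ (D_h ⊗ 𝔸)^×` iff `G_∞ ∈ (D_h ⊗ ℝ)^×` and `G_f ∈ (D_h ⊗ 𝔸_{L⁺,f})^×`** (twin of ★ `mem_adelic_iff_toMixed_sndHom`). [cite: BorelJacquet1979, §4.1] -/
theorem mem_quatAdelicUnits_iff_toMixed_sndHom (G : GL (Fin 2) (AdeleRing (𝓞 L) L)) :
    G ∈ quatAdelicUnits L Ha ↔ GLn.toMixed 2 L G ∈ quatArchUnits L Ha ∧ GLn.sndHom 2 L G ∈ quatFinAdelicUnits L Ha := by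
  rw [mem_quatAdelicUnits_iff, mem_quatAdelic_iff, matrix_adele_eq_iff, map_adeleFst_rel_iff, map_adeleSnd_rel_iff]

/-- `G_f ∈ (D_h ⊗ 𝔸_{L⁺,f})^×` for `G ∈ (D_h ⊗ 𝔸)^×`. [cite: BorelJacquet1979, §4.1] -/
theorem sndHom_mem_quatFinAdelicUnits {G : GL (Fin 2) (AdeleRing (𝓞 L) L)} (hG : G ∈ quatAdelicUnits L Ha) :
    GLn.sndHom 2 L G ∈ quatFinAdelicUnits L Ha :=
  ((mem_quatAdelicUnits_iff_toMixed_sndHom L Ha G).1 hG).2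

/-- `G_∞ ∈ (D_h ⊗ ℝ)^×` for `G ∈ (D_h ⊗ 𝔸)^×`. [cite: BorelJacquet1979, §4.1] -/
theorem toMixed_mem_quatArchUnits {G : GL (Fin 2) (AdeleRing (𝓞 L) L)} (hG : G ∈ quatAdelicUnits L Ha) :
    GLn.toMixed 2 L G ∈ quatArchUnits L Ha :=
  ((mem_quatAdelicUnits_iff_toMixed_sndHom L Ha G).1 hG).1

/-- **`(1, g) ∈ (D_h ⊗ 𝔸)^× ↔ g ∈ (D_h ⊗ 𝔸_{L⁺,f})^×`.** [cite: BorelJacquet1979, §4.1] -/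
theorem ofFinite_mem_quatAdelicUnits_iff (g : GL (Fin 2) (FiniteAdeleRing (𝓞 L) L)) :
    GLn.ofFinite 2 L g ∈ quatAdelicUnits L Ha ↔ g ∈ quatFinAdelicUnits L Ha := by
  rw [mem_quatAdelicUnits_iff_toMixed_sndHom, GLn.toMixed_ofFinite, GLn.sndHom_ofFinite]
  exact ⟨fun h => h.2, fun h => ⟨one_mem _, h⟩⟩

/-- **`(g, 1) ∈ (D_h ⊗ 𝔸)^× ↔ g ∈ (D_h ⊗ ℝ)^×`.** [cite: BorelJacquet1979, §4.1] -/
theorem ofInfinite_mem_quatAdelicUnits_iff (g : GL (Fin 2) (mixedSpace L)) :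
    GLn.ofInfinite 2 L g ∈ quatAdelicUnits L Ha ↔ g ∈ quatArchUnits L Ha := by
  rw [mem_quatAdelicUnits_iff_toMixed_sndHom, GLn.toMixed_ofInfinite, GLn.sndHom_ofInfinite]
  exact ⟨fun h => h.1, fun h => ⟨h, one_mem _⟩⟩

/-! ## §3 The component homomorphisms and `(D_h ⊗ 𝔸)^× ≃ₜ* (D_h ⊗ ℝ)^× × (D_h ⊗ 𝔸_{L⁺,f})^×` -/

/-- **The archimedean component `(D_h ⊗ 𝔸)^× →* (D_h ⊗ ℝ)^×`, `g ↦ g_∞`** (restriction of ★ `GLn.toMixed`). [cite: BorelJacquet1979, §4.1] -/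
def quatArchPart : ↥(quatAdelicUnits L Ha) →* ↥(quatArchUnits L Ha) :=
  ((GLn.toMixed 2 L).comp (quatAdelicUnits L Ha).subtype).codRestrict (quatArchUnits L Ha) fun g => toMixed_mem_quatArchUnits L Ha g.2

/-- **The finite component `(D_h ⊗ 𝔸)^× →* (D_h ⊗ 𝔸_{L⁺,f})^×`, `g ↦ g_f`** (restriction of ★ `GLn.sndHom`). [cite: BorelJacquet1979, §4.1] -/
def quatFinPart : ↥(quatAdelicUnits L Ha) →* ↥(quatFinAdelicUnits L Ha) :=
  ((GLn.sndHom 2 L).comp (quatAdelicUnits L Ha).subtype).codRestrict (quatFinAdelicUnits L Ha) fun g => sndHom_mem_quatFinAdelicUnits L Ha g.2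

/-- **`(D_h ⊗ ℝ)^× →* (D_h ⊗ 𝔸)^×`, `g ↦ (g, 1)`** (restriction of ★ `GLn.ofInfinite`). [cite: BorelJacquet1979, §4.1] -/
def quatArchToAdelic : ↥(quatArchUnits L Ha) →* ↥(quatAdelicUnits L Ha) :=
  ((GLn.ofInfinite 2 L).comp (quatArchUnits L Ha).subtype).codRestrict (quatAdelicUnits L Ha) fun g => (ofInfinite_mem_quatAdelicUnits_iff L Ha g.1).2 g.2

/-- **`(D_h ⊗ 𝔸_{L⁺,f})^× →* (D_h ⊗ 𝔸)^×`, `g ↦ (1, g)`** (restriction of ★ `GLn.ofFinite`). [cite: BorelJacquet1979, §4.1] -/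
def quatFinAdelicToAdelic : ↥(quatFinAdelicUnits L Ha) →* ↥(quatAdelicUnits L Ha) :=
  ((GLn.ofFinite 2 L).comp (quatFinAdelicUnits L Ha).subtype).codRestrict (quatAdelicUnits L Ha) fun g => (ofFinite_mem_quatAdelicUnits_iff L Ha g.1).2 g.2

/-- `quatArchPart g = g_∞` in `GL₂(L ⊗ ℝ)`. [folklore] -/
@[simp] theorem coe_quatArchPart (g : ↥(quatAdelicUnits L Ha)) :
    ((quatArchPart L Ha g : ↥(quatArchUnits L Ha)) : GL (Fin 2) (mixedSpace L)) = GLn.toMixed 2 L g.1 := rfl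

/-- `quatFinPart g = g_f` in `GL₂(𝔸_{L,f})`. [folklore] -/
@[simp] theorem coe_quatFinPart (g : ↥(quatAdelicUnits L Ha)) :
    ((quatFinPart L Ha g : ↥(quatFinAdelicUnits L Ha)) : GL (Fin 2) (FiniteAdeleRing (𝓞 L) L)) = GLn.sndHom 2 L g.1 := rfl

/-- `quatArchToAdelic a = (a, 1)` in `GL₂(𝔸_L)`. [folklore] -/
@[simp] theorem coe_quatArchToAdelic (a : ↥(quatArchUnits L Ha)) :
    ((quatArchToAdelic L Ha a : ↥(quatAdelicUnits L Ha)) : GL (Fin 2) (AdeleRing (𝓞 L) L)) = GLn.ofInfinite 2 L a.1 := rfl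

/-- `quatFinAdelicToAdelic b = (1, b)` in `GL₂(𝔸_L)`. [folklore] -/
@[simp] theorem coe_quatFinAdelicToAdelic (b : ↥(quatFinAdelicUnits L Ha)) :
    ((quatFinAdelicToAdelic L Ha b : ↥(quatAdelicUnits L Ha)) : GL (Fin 2) (AdeleRing (𝓞 L) L)) = GLn.ofFinite 2 L b.1 := rfl

/-- `quatArchPart` is continuous. [folklore] -/
theorem continuous_quatArchPart : Continuous (quatArchPart L Ha) :=
  ((GLn.continuous_toMixed 2 L).comp continuous_subtype_val).subtype_mk _

/-- `quatFinPart` is continuous. [folklore] -/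
theorem continuous_quatFinPart : Continuous (quatFinPart L Ha) :=
  ((continuous_snd.generalLinearGroup_map : Continuous (GLn.sndHom 2 L)).comp continuous_subtype_val).subtype_mk _

/-- `quatArchToAdelic` is continuous. [folklore] -/
theorem continuous_quatArchToAdelic : Continuous (quatArchToAdelic L Ha) :=
  ((GLn.continuous_ofInfinite 2 L).comp continuous_subtype_val).subtype_mk _

/-- `quatFinAdelicToAdelic` is continuous. [folklore] -/
theorem continuous_quatFinAdelicToAdelic : Continuous (quatFinAdelicToAdelic L Ha) :=
  ((GLn.continuous_ofFinite 2 L).comp continuous_subtype_val).subtype_mk _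

/-- `(a, 1)_∞ = a`. [folklore] -/
@[simp] theorem quatArchPart_quatArchToAdelic (a : ↥(quatArchUnits L Ha)) : quatArchPart L Ha (quatArchToAdelic L Ha a) = a :=
  Subtype.ext (GLn.toMixed_ofInfinite (n := 2) (K := L) a.1)

/-- `(1, b)_∞ = 1`. [folklore] -/
@[simp] theorem quatArchPart_quatFinAdelicToAdelic (b : ↥(quatFinAdelicUnits L Ha)) : quatArchPart L Ha (quatFinAdelicToAdelic L Ha b) = 1 :=
  Subtype.ext (GLn.toMixed_ofFinite (n := 2) (K := L) b.1)

/-- `(a, 1)_f = 1`. [folklore] -/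
@[simp] theorem quatFinPart_quatArchToAdelic (a : ↥(quatArchUnits L Ha)) : quatFinPart L Ha (quatArchToAdelic L Ha a) = 1 :=
  Subtype.ext (GLn.sndHom_ofInfinite (n := 2) (K := L) a.1)

/-- `(1, b)_f = b`. [folklore] -/
@[simp] theorem quatFinPart_quatFinAdelicToAdelic (b : ↥(quatFinAdelicUnits L Ha)) : quatFinPart L Ha (quatFinAdelicToAdelic L Ha b) = b :=
  Subtype.ext (GLn.sndHom_ofFinite (n := 2) (K := L) b.1)

/-- **`g = (g_∞, 1) · (1, g_f)`** in `(D_h ⊗ 𝔸)^×`. [cite: BorelJacquet1979, §4.1] -/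
theorem quatArchToAdelic_mul_quatFinAdelicToAdelic (g : ↥(quatAdelicUnits L Ha)) :
    quatArchToAdelic L Ha (quatArchPart L Ha g) * quatFinAdelicToAdelic L Ha (quatFinPart L Ha g) = g :=
  Subtype.ext (GLn.ofInfinite_toMixed_mul_ofFinite_sndHom (n := 2) (K := L) g.1)

/-- The archimedean and finite factors commute inside `(D_h ⊗ 𝔸)^×`. [folklore] -/
theorem commute_quatArchToAdelic_quatFinAdelicToAdelic (a : ↥(quatArchUnits L Ha)) (b : ↥(quatFinAdelicUnits L Ha)) :
    Commute (quatArchToAdelic L Ha a) (quatFinAdelicToAdelic L Ha b) := by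
  rw [Commute, SemiconjBy]
  exact Subtype.ext (GLn.commute_ofInfinite_ofFinite (n := 2) (K := L) a.1 b.1).eq

/-- **MAIN DEFINITION. `(D_h ⊗ 𝔸)^× ≃ₜ* (D_h ⊗ ℝ)^× × (D_h ⊗ 𝔸_{L⁺,f})^×`** as topological groups: `g ↦ (g_∞, g_f)`, inverse `(a, b) ↦ (a,1)·(1,b)` (twin of ★
`UnitaryGroup.adelicProdEquiv`). [cite: BorelJacquet1979, §4.1 (G(𝔸) = G_∞ × G(𝔸_f))] [cite: VignerasLNM800, Ch. III §1] -/
def quatAdelicProdEquiv : ↥(quatAdelicUnits L Ha) ≃ₜ* ↥(quatArchUnits L Ha) × ↥(quatFinAdelicUnits L Ha) where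
  toFun g := (quatArchPart L Ha g, quatFinPart L Ha g)
  invFun p := quatArchToAdelic L Ha p.1 * quatFinAdelicToAdelic L Ha p.2
  left_inv g := quatArchToAdelic_mul_quatFinAdelicToAdelic L Ha g
  right_inv p := by
    refine Prod.ext ?_ ?_
    · simp only [map_mul, quatArchPart_quatArchToAdelic, quatArchPart_quatFinAdelicToAdelic, mul_one]
    · simp only [map_mul, quatFinPart_quatArchToAdelic, quatFinPart_quatFinAdelicToAdelic, one_mul]
  map_mul' g h := Prod.ext (map_mul _ g h) (map_mul _ g h)
  continuous_toFun := (continuous_quatArchPart L Ha).prodMk (continuous_quatFinPart L Ha)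
  continuous_invFun := ((continuous_quatArchToAdelic L Ha).comp continuous_fst).mul ((continuous_quatFinAdelicToAdelic L Ha).comp continuous_snd)

/-- `quatAdelicProdEquiv g = (g_∞, g_f)`. [folklore] -/
@[simp] theorem quatAdelicProdEquiv_apply (g : ↥(quatAdelicUnits L Ha)) :
    quatAdelicProdEquiv L Ha g = (quatArchPart L Ha g, quatFinPart L Ha g) := rfl

/-- `quatAdelicProdEquiv.symm (a, b) = (a,1)·(1,b)`. [folklore] -/
@[simp] theorem quatAdelicProdEquiv_symm_apply (p : ↥(quatArchUnits L Ha) × ↥(quatFinAdelicUnits L Ha)) :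
    (quatAdelicProdEquiv L Ha).symm p = quatArchToAdelic L Ha p.1 * quatFinAdelicToAdelic L Ha p.2 := rfl

/-- `quatArchPart` is surjective. [folklore] -/
theorem quatArchPart_surjective : Function.Surjective (quatArchPart L Ha) :=
  fun a => ⟨quatArchToAdelic L Ha a, quatArchPart_quatArchToAdelic L Ha a⟩

/-- `quatFinPart` is surjective. [folklore] -/
theorem quatFinPart_surjective : Function.Surjective (quatFinPart L Ha) :=
  fun b => ⟨quatFinAdelicToAdelic L Ha b, quatFinPart_quatFinAdelicToAdelic L Ha b⟩

/-- **The level has no archimedean condition**: `x ∈ ∏_v Λ_v^×` (★ #3i `quatAdelicUnitsLevel`) iff its finite part lies in `K_f` (★ #3m ED. 1 `quatFinAdelicUnitsLevel`) (definitional).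
[cite: VignerasLNM800, Ch. III §1] -/
theorem mem_quatAdelicUnitsLevel_iff_quatFinPart_mem (x : ↥(quatAdelicUnits L Ha)) :
    x ∈ quatAdelicUnitsLevel L Ha ↔ quatFinPart L Ha x ∈ quatFinAdelicUnitsLevel L Ha :=
  Iff.rfl

/-- The level is the pull-back of `K_f` along `quatFinPart`. [cite: VignerasLNM800, Ch. III §1] -/
theorem quatAdelicUnitsLevel_eq_comap : quatAdelicUnitsLevel L Ha = (quatFinAdelicUnitsLevel L Ha).comap (quatFinPart L Ha) :=
  Subgroup.ext fun x => mem_quatAdelicUnitsLevel_iff_quatFinPart_mem L Ha x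

/-- Under `quatAdelicProdEquiv` the level is `(D_h ⊗ ℝ)^× × K_f`: `x ∈ level ↔ (quatAdelicProdEquiv x).2 ∈ K_f`. [cite: BorelJacquet1979, §4.1] -/
theorem mem_quatAdelicUnitsLevel_iff_quatAdelicProdEquiv_snd_mem (x : ↥(quatAdelicUnits L Ha)) :
    x ∈ quatAdelicUnitsLevel L Ha ↔ (quatAdelicProdEquiv L Ha x).2 ∈ quatFinAdelicUnitsLevel L Ha :=
  Iff.rfl

/-! ## §4 Compatibility with the local projections: `x_v = quatLocalPiEquiv v (quatEvalPlace v x_f)` -/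

variable (v : HeightOneSpectrum (𝓞 ↥(maximalRealSubfield L)))

/-- Entries of ★ #3i's `v`-component: `(x_v)_{ij} = ((x_{ij})_f)_w` at `w ∣ v` (★ `adeleToLocal_apply`). [folklore] -/
theorem coe_quatAdelicUnitsToLocal_apply (x : ↥(quatAdelicUnits L Ha)) (i j : Fin 2) (w : PlacesOver L v) :
    (((quatAdelicUnitsToLocal L Ha v x : ↥(quatLocalUnits L Ha v)) : GL (Fin 2) (LocalRing L v)) : Matrix (Fin 2) (Fin 2) (LocalRing L v)) i j w =
      (((x.1 : GL (Fin 2) (AdeleRing (𝓞 L) L)) : Matrix (Fin 2) (Fin 2) (AdeleRing (𝓞 L) L)) i j).2 w.1 :=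
  rfl

/-- **COMPATIBILITY (pointwise).** ★ #3i's `v`-component `quatAdelicUnitsToLocal v x ∈ (D_v)^× ≤ GL₂(E_v)` IS the `v`-component of the finite part of `x` in the restricted product,
read on the matrix carrier: `quatAdelicUnitsToLocal v x = quatLocalPiEquiv v (quatEvalPlace v (quatFinPart x))` (both have entries `(i,j,w) ↦ ((x_{ij})_f)_w`; twin of ★
`localPiEquiv_evalPlace`). [cite: PlatonovRapinchuk1994, §5.1] [cite: VignerasLNM800, Ch. III §1 (X_A → X_v)] -/
theorem quatAdelicUnitsToLocal_eq_quatLocalPiEquiv_quatEvalPlace (x : ↥(quatAdelicUnits L Ha)) :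
    quatAdelicUnitsToLocal L Ha v x = quatLocalPiEquiv L Ha v (quatEvalPlace L Ha v (quatFinPart L Ha x)) := by
  refine Subtype.ext (Units.ext (Matrix.ext fun i j => funext fun w => ?_))
  rw [coe_quatAdelicUnitsToLocal_apply, coe_quatLocalPiEquiv_quatEvalPlace_apply]
  rfl

/-- **COMPATIBILITY (as homomorphisms)**: `quatAdelicUnitsToLocal v = quatLocalPiEquiv v ∘ quatEvalPlace v ∘ quatFinPart`. [cite: PlatonovRapinchuk1994, §5.1] -/
theorem quatAdelicUnitsToLocal_eq_comp :
    quatAdelicUnitsToLocal L Ha v = (quatLocalPiEquiv L Ha v).toMonoidHom.comp ((quatEvalPlace L Ha v).comp (quatFinPart L Ha)) :=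
  MonoidHom.ext fun x => quatAdelicUnitsToLocal_eq_quatLocalPiEquiv_quatEvalPlace L Ha v x

/-- The same through `quatAdelicProdEquiv`: `x_v = quatLocalPiEquiv v ((quatFinAdelicEquiv (quatAdelicProdEquiv x).2) v)`. [cite: PlatonovRapinchuk1994, §5.1] -/
theorem quatAdelicUnitsToLocal_eq_of_quatAdelicProdEquiv (x : ↥(quatAdelicUnits L Ha)) :
    quatAdelicUnitsToLocal L Ha v x = quatLocalPiEquiv L Ha v (quatFinAdelicEquiv L Ha (quatAdelicProdEquiv L Ha x).2 v) :=
  quatAdelicUnitsToLocal_eq_quatLocalPiEquiv_quatEvalPlace L Ha v x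

/-- `(quatLocalPiEquiv v).symm (x_v) = quatEvalPlace v x_f` (the compatibility read on the factor carrier). [cite: PlatonovRapinchuk1994, §5.1] -/
theorem quatLocalPiEquiv_symm_quatAdelicUnitsToLocal (x : ↥(quatAdelicUnits L Ha)) :
    (quatLocalPiEquiv L Ha v).symm (quatAdelicUnitsToLocal L Ha v x) = quatEvalPlace L Ha v (quatFinPart L Ha x) := by
  rw [quatAdelicUnitsToLocal_eq_quatLocalPiEquiv_quatEvalPlace, ContinuousMulEquiv.symm_apply_apply]

/-- **Almost all local components of `x ∈ (D_h ⊗ 𝔸)^×` are integral**: `x_v ∈ Λ_v^×` for all but finitely many `v` (★ #3m ED. 1 `eventually_quatEvalPlace_mem` transported).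
[cite: PlatonovRapinchuk1994, §5.1] -/
theorem eventually_quatAdelicUnitsToLocal_mem_level (x : ↥(quatAdelicUnits L Ha)) :
    ∀ᶠ v in cofinite, ((quatAdelicUnitsToLocal L Ha v x : ↥(quatLocalUnits L Ha v)) : GL (Fin 2) (LocalRing L v)) ∈ quatLocalUnitsLevel L Ha v :=
  (eventually_quatLocalPiEquiv_quatEvalPlace_mem_level L Ha (quatFinPart L Ha x)).mono fun v hv => by
    rwa [quatAdelicUnitsToLocal_eq_quatLocalPiEquiv_quatEvalPlace]

/-! ## §5 The level `∏_v Λ_v^×` of `(D_h ⊗ 𝔸)^×` read placewise through ★ #3i's `quatAdelicUnitsToLocal` -/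

/-- **`x ∈ ∏_v Λ_v^× ↔ ∀ v, x_v ∈ Λ_v^×`** — ★ #3i's adelic level IS the product of ★ #3f's local levels under the local projections (★ #3m ED. 1
`mem_quatFinAdelicUnitsLevel_iff_forall_level` + §4). [cite: VignerasLNM800, Ch. III §1 (unités des ordres ∏ 𝒪_v^×)] [cite: PlatonovRapinchuk1994, §5.1] -/
theorem mem_quatAdelicUnitsLevel_iff_forall_toLocal (x : ↥(quatAdelicUnits L Ha)) :
    x ∈ quatAdelicUnitsLevel L Ha ↔
      ∀ v : HeightOneSpectrum (𝓞 ↥(maximalRealSubfield L)),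
        ((quatAdelicUnitsToLocal L Ha v x : ↥(quatLocalUnits L Ha v)) : GL (Fin 2) (LocalRing L v)) ∈ quatLocalUnitsLevel L Ha v := by
  rw [mem_quatAdelicUnitsLevel_iff_quatFinPart_mem, mem_quatFinAdelicUnitsLevel_iff_forall_level]
  refine forall_congr' fun v => ?_
  rw [quatAdelicUnitsToLocal_eq_quatLocalPiEquiv_quatEvalPlace]

/-- The same on the factor carrier: `x ∈ ∏_v Λ_v^× ↔ ∀ v, quatEvalPlace v x_f ∈ quatLocalPiInt v`. [cite: PlatonovRapinchuk1994, §5.1] -/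
theorem mem_quatAdelicUnitsLevel_iff_forall_quatEvalPlace (x : ↥(quatAdelicUnits L Ha)) :
    x ∈ quatAdelicUnitsLevel L Ha ↔
      ∀ v : HeightOneSpectrum (𝓞 ↥(maximalRealSubfield L)), quatEvalPlace L Ha v (quatFinPart L Ha x) ∈ quatLocalPiInt L Ha v :=
  (mem_quatAdelicUnitsLevel_iff_quatFinPart_mem L Ha x).trans (mem_quatFinAdelicUnitsLevel_iff_forall L Ha _)

/-! ## §6 Topology of the archimedean factor -/

/-- `(D_h ⊗ ℝ)^×` is locally compact (closed in `GL₂(L ⊗ ℝ)`, itself the units of the locally compact ring `M₂(L ⊗ ℝ)`). [cite: PlatonovRapinchuk1994, §3.2] -/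
theorem locallyCompactSpace_quatArchUnits : LocallyCompactSpace ↥(quatArchUnits L Ha) := by
  haveI : LocallyCompactSpace (Matrix (Fin 2) (Fin 2) (mixedSpace L)) := inferInstanceAs (LocallyCompactSpace (Fin 2 → Fin 2 → mixedSpace L))
  haveI : LocallyCompactSpace (GL (Fin 2) (mixedSpace L)) := inferInstance
  exact (isClosed_quatArchUnits L Ha).isClosedEmbedding_subtypeVal.locallyCompactSpace

/-- `(D_h ⊗ ℝ)^×` is second countable. [cite: PlatonovRapinchuk1994, §3.2] -/
theorem secondCountableTopology_quatArchUnits : SecondCountableTopology ↥(quatArchUnits L Ha) := by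
  haveI : SecondCountableTopology (Matrix (Fin 2) (Fin 2) (mixedSpace L)) := inferInstanceAs (SecondCountableTopology (Fin 2 → Fin 2 → mixedSpace L))
  haveI : SecondCountableTopology (Matrix (Fin 2) (Fin 2) (mixedSpace L))ᵐᵒᵖ := MulOpposite.opHomeomorph.symm.secondCountableTopology
  haveI : SecondCountableTopology (GL (Fin 2) (mixedSpace L)) := Units.isEmbedding_embedProduct.secondCountableTopology
  exact Topology.IsEmbedding.subtypeVal.secondCountableTopology

end Summit.HodgeConjecture.HodgeConjecture.Cruxes.H413.K2E5QuatAdelicProdDecomposition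

end
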